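import Summits.Ventures.LatticeQCDFlow.Exactness.IMHTauIntExact
import HarnessLib

/-!
# The exact `τ_int` of row 2's φ⁴ flow sampler: the lattice instances

HONEST FRAMING: exact (Metropolis-corrected) sampling algorithms for lattice gauge theory;
figures of merit are autocorrelation/cost numbers at stated couplings and volumes; no
continuum-physics claim.  (SCALAR calibration rung S0-A: not a gauge result.)

Venture `LatticeQCDFlow` (cell pub-lqcd), topic `Exactness`; FANOUT row 2 (`s0-phi4`, FLOW arm:
real-NVP proposals `q̃` on `ℝ^Λ` + independence-Metropolis accept/reject against `e^{−S}`,
`S` the lattice φ⁴ action `latticePhi4Action J λ`).  NEW WORK of the cell: the general-state-space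
theorems of `IMHSmithTierney.lean`, `IMHAutocovLayerCake.lean` and `IMHTauIntExact.lean`
specialised to row 2's operator `imhOpPhi4 J λ q̃ = imhOp volume (gibbsWeight J λ) q̃`.
Nothing is cited as a fact.

## What is proved (every `λ > 0`, real `J`, positive measurable model density `q̃` with `∫ q̃ = 1`,
`b = e^{−S}/q̃`, `λ(·)` the rejection curve `rejCurve volume (gibbsWeight J λ) q̃`,
`T_{k+1} = stKernel`, `f` bounded measurable, `g = f − ⟨f⟩`, `G(u) = ∫ 1[b < u] g e^{−S} dφ`)

* **`phi4Flow_iterate_succ_eq`** — the Smith–Tierney law of row 2's sampler: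
  `(K^{k+1} f)(φ) = ∫ T_{k+1}(b(φ) ∨ b(φ')) f(φ') e^{−S(φ')} dφ' + λ(b(φ))^{k+1} f(φ)`;
* `phi4Flow_autocov_succ_eq_layerCake` —
  `∫ g (K^{k+1} g) e^{−S} = ∫_{u>0} (k+1)λ(u)ᵏ/u² G(u)² du + ∫ g² e^{−S} λ(b)^{k+1}`;
* **`phi4Flow_hasSum_autocov`**, **`phi4Flow_summable_autocov_iff`** — the Green–Kubo sum
  equals `I + J`, `I = ∫_{u>0} G²/(u(1−λ))² du`, `J = ∫ g² e^{−S} λ(b)/(1−λ(b)) dφ`, and is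
  summable iff both are finite;
* **`phi4Flow_tauInt_eq`** — `τ_int(f) = ½ + (I + J) / ∫ g² e^{−S} dφ` on `Scoring.tauInt`.

Reading for S0-A (no numerics implied): `τ_int` of the flow arm for any observable is a
deterministic functional of the joint law of `(f, e^{−S}/q̃)` under the target, estimable from
i.i.d. model draws with importance weights — an independent cross-check of a chain-side `τ_int`
estimate.  NOT CLAIMED: HMC / local Metropolis; unbounded observables; any number for a trained
network.
-/

namespace Summit.Ventures.LatticeQCDFlow.Exactness

open Real MeasureTheory Filter Set Topology
open Summit.Ventures.LatticeQCDFlow.Scoring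

/-! ## The lattice: row 2's φ⁴ flow sampler -/

section Lattice

variable {n : ℕ}

/-- **THE SMITH–TIERNEY LAW OF THE φ⁴ FLOW SAMPLER.**  Every `λ > 0`, real `J`, positive
measurable model density `q̃` with `∫ q̃ = 1` (`b = e^{−S}/q̃`); `f` bounded measurable.  For every
`k` and every configuration `φ`:
`(K^{k+1} f)(φ) = ∫ T_{k+1}(b(φ) ∨ b(φ')) f(φ') e^{−S(φ')} dφ' + λ(b(φ))^{k+1} f(φ)`. -/
theorem phi4Flow_iterate_succ_eq {lam : ℝ} (hlam : 0 < lam) (J : Fin (n + 1) → Fin (n + 1) → ℝ)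
    {q : (Fin (n + 1) → ℝ) → ℝ} (hq0 : ∀ φ, 0 < q φ) (hqm : Measurable q) (hqi : Integrable q)
    (hq1 : ∫ φ, q φ = 1) {f : (Fin (n + 1) → ℝ) → ℝ} (hfm : Measurable f) {B : ℝ}
    (hfb : ∀ φ, |f φ| ≤ B) (k : ℕ) (φ : Fin (n + 1) → ℝ) :
    ((imhOpPhi4 J lam q)^[k + 1] f) φ
      = (∫ φ', stKernel volume (gibbsWeight J lam) q k
            (max (gibbsWeight J lam φ / q φ) (gibbsWeight J lam φ' / q φ'))
          * f φ' * gibbsWeight J lam φ')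
        + rejCurve volume (gibbsWeight J lam) q (gibbsWeight J lam φ / q φ) ^ (k + 1) * f φ := by
  rw [imhOpPhi4_eq_imhOp]
  exact imhOp_iterate_succ_eq (μ := volume) (fun ψ => gibbsWeight_pos J lam ψ)
    (continuous_gibbsWeight J lam).measurable (integrable_gibbsWeight hlam J) hq0 hqm hqi hq1
    k hfm hfb φ

/-- **Layer-cake form of the φ⁴ flow sampler's autocovariances**: with `g = f − ⟨f⟩`, for every
`k`: `∫ g (K^{k+1} g) e^{−S} dφ = ∫_{u>0} (k+1)λ(u)ᵏ/u² (∫ 1[b<u] g e^{−S})² du + ∫ g² e^{−S} λ(b)^{k+1} dφ`. -/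
theorem phi4Flow_autocov_succ_eq_layerCake {lam : ℝ} (hlam : 0 < lam)
    (J : Fin (n + 1) → Fin (n + 1) → ℝ) {q : (Fin (n + 1) → ℝ) → ℝ} (hq0 : ∀ φ, 0 < q φ)
    (hqm : Measurable q) (hqi : Integrable q) (hq1 : ∫ φ, q φ = 1)
    {f : (Fin (n + 1) → ℝ) → ℝ} (hfm : Measurable f) {B : ℝ} (hfb : ∀ φ, |f φ| ≤ B) (k : ℕ) :
    ∫ φ, (f φ - gibbsExpect J lam f)
        * ((imhOpPhi4 J lam q)^[k + 1] (fun ψ => f ψ - gibbsExpect J lam f)) φ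
        * gibbsWeight J lam φ
      = (∫ u in Ioi (0:ℝ), ((k : ℝ) + 1) * rejCurve volume (gibbsWeight J lam) q u ^ k / u ^ 2
          * (∫ φ, (if gibbsWeight J lam φ / q φ < u then
              (f φ - gibbsExpect J lam f) * gibbsWeight J lam φ else 0)) ^ 2)
        + ∫ φ, (f φ - gibbsExpect J lam f) ^ 2 * gibbsWeight J lam φ
          * rejCurve volume (gibbsWeight J lam) q (gibbsWeight J lam φ / q φ) ^ (k + 1) := by
  obtain ⟨hgm, hgb, -⟩ := centred_observable hlam J hfm hfb
  rw [imhOpPhi4_eq_imhOp]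
  exact autocov_succ_eq_layerCake (μ := volume) (fun ψ => gibbsWeight_pos J lam ψ)
    (continuous_gibbsWeight J lam).measurable (integrable_gibbsWeight hlam J) hq0 hqm hqi hq1
    k hgm hgb

/-- **Summability criterion for the φ⁴ flow sampler**: the autocovariance series of `g = f − ⟨f⟩`
is summable iff the two weight functionals `I`, `J` are finite. -/
theorem phi4Flow_summable_autocov_iff {lam : ℝ} (hlam : 0 < lam)
    (J : Fin (n + 1) → Fin (n + 1) → ℝ) {q : (Fin (n + 1) → ℝ) → ℝ} (hq0 : ∀ φ, 0 < q φ)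
    (hqm : Measurable q) (hqi : Integrable q) (hq1 : ∫ φ, q φ = 1)
    {f : (Fin (n + 1) → ℝ) → ℝ} (hfm : Measurable f) {B : ℝ} (hfb : ∀ φ, |f φ| ≤ B) :
    (Summable fun k => ∫ φ, (f φ - gibbsExpect J lam f)
        * ((imhOpPhi4 J lam q)^[k + 1] (fun ψ => f ψ - gibbsExpect J lam f)) φ
        * gibbsWeight J lam φ)
      ↔ IntegrableOn (fun u : ℝ => (∫ φ, (if gibbsWeight J lam φ / q φ < u then
            (f φ - gibbsExpect J lam f) * gibbsWeight J lam φ else 0)) ^ 2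
            / (u * (1 - rejCurve volume (gibbsWeight J lam) q u)) ^ 2) (Ioi 0)
        ∧ Integrable (fun φ => (f φ - gibbsExpect J lam f) ^ 2 * gibbsWeight J lam φ
            * (rejCurve volume (gibbsWeight J lam) q (gibbsWeight J lam φ / q φ)
              / (1 - rejCurve volume (gibbsWeight J lam) q (gibbsWeight J lam φ / q φ)))) := by
  obtain ⟨hgm, hgb, -⟩ := centred_observable hlam J hfm hfb
  rw [imhOpPhi4_eq_imhOp]
  exact summable_autocov_iff (μ := volume) (fun ψ => gibbsWeight_pos J lam ψ)
    (continuous_gibbsWeight J lam).measurable (integrable_gibbsWeight hlam J) hq0 hqm hqi hq1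
    hgm hgb

/-- **CLOSED-FORM GREEN–KUBO SUM FOR THE φ⁴ FLOW SAMPLER**: with `g = f − ⟨f⟩`,
`G(u) = ∫ 1[b < u] g e^{−S}`, `λ` the rejection curve of row 2's sampler, finite weight
functionals give `Σ_k ∫ g (K^{k+1} g) e^{−S} = ∫_{u>0} G²/(u(1−λ))² du + ∫ g² e^{−S} λ(b)/(1−λ(b))`. -/
theorem phi4Flow_hasSum_autocov {lam : ℝ} (hlam : 0 < lam) (J : Fin (n + 1) → Fin (n + 1) → ℝ)
    {q : (Fin (n + 1) → ℝ) → ℝ} (hq0 : ∀ φ, 0 < q φ) (hqm : Measurable q) (hqi : Integrable q)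
    (hq1 : ∫ φ, q φ = 1) {f : (Fin (n + 1) → ℝ) → ℝ} (hfm : Measurable f) {B : ℝ}
    (hfb : ∀ φ, |f φ| ≤ B)
    (hI : IntegrableOn (fun u : ℝ => (∫ φ, (if gibbsWeight J lam φ / q φ < u then
        (f φ - gibbsExpect J lam f) * gibbsWeight J lam φ else 0)) ^ 2
      / (u * (1 - rejCurve volume (gibbsWeight J lam) q u)) ^ 2) (Ioi 0))
    (hJ : Integrable (fun φ => (f φ - gibbsExpect J lam f) ^ 2 * gibbsWeight J lam φ
      * (rejCurve volume (gibbsWeight J lam) q (gibbsWeight J lam φ / q φ)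
        / (1 - rejCurve volume (gibbsWeight J lam) q (gibbsWeight J lam φ / q φ))))) :
    HasSum (fun k => ∫ φ, (f φ - gibbsExpect J lam f)
        * ((imhOpPhi4 J lam q)^[k + 1] (fun ψ => f ψ - gibbsExpect J lam f)) φ
        * gibbsWeight J lam φ)
      ((∫ u in Ioi (0:ℝ), (∫ φ, (if gibbsWeight J lam φ / q φ < u then
          (f φ - gibbsExpect J lam f) * gibbsWeight J lam φ else 0)) ^ 2
          / (u * (1 - rejCurve volume (gibbsWeight J lam) q u)) ^ 2)
        + ∫ φ, (f φ - gibbsExpect J lam f) ^ 2 * gibbsWeight J lam φ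
          * (rejCurve volume (gibbsWeight J lam) q (gibbsWeight J lam φ / q φ)
            / (1 - rejCurve volume (gibbsWeight J lam) q (gibbsWeight J lam φ / q φ)))) := by
  obtain ⟨hgm, hgb, -⟩ := centred_observable hlam J hfm hfb
  rw [imhOpPhi4_eq_imhOp]
  exact hasSum_autocov_layerCake (μ := volume) (fun ψ => gibbsWeight_pos J lam ψ)
    (continuous_gibbsWeight J lam).measurable (integrable_gibbsWeight hlam J) hq0 hqm hqi hq1
    hgm hgb hI hJ

/-- **THE EXACT `τ_int` OF THE φ⁴ FLOW SAMPLER**: with `g = f − ⟨f⟩` and finite weight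
functionals, `τ_int(f) = ½ + [∫_{u>0} G²/(u(1−λ))² du + ∫ g² e^{−S} λ(b)/(1−λ(b)) dφ] / ∫ g² e^{−S} dφ`
— a deterministic functional of the joint law of `(f, e^{−S}/q̃)` under the target. -/
theorem phi4Flow_tauInt_eq {lam : ℝ} (hlam : 0 < lam) (J : Fin (n + 1) → Fin (n + 1) → ℝ)
    {q : (Fin (n + 1) → ℝ) → ℝ} (hq0 : ∀ φ, 0 < q φ) (hqm : Measurable q) (hqi : Integrable q)
    (hq1 : ∫ φ, q φ = 1) {f : (Fin (n + 1) → ℝ) → ℝ} (hfm : Measurable f) {B : ℝ}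
    (hfb : ∀ φ, |f φ| ≤ B)
    (hI : IntegrableOn (fun u : ℝ => (∫ φ, (if gibbsWeight J lam φ / q φ < u then
        (f φ - gibbsExpect J lam f) * gibbsWeight J lam φ else 0)) ^ 2
      / (u * (1 - rejCurve volume (gibbsWeight J lam) q u)) ^ 2) (Ioi 0))
    (hJ : Integrable (fun φ => (f φ - gibbsExpect J lam f) ^ 2 * gibbsWeight J lam φ
      * (rejCurve volume (gibbsWeight J lam) q (gibbsWeight J lam φ / q φ)
        / (1 - rejCurve volume (gibbsWeight J lam) q (gibbsWeight J lam φ / q φ))))) :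
    tauInt (fun k => (∫ φ, (f φ - gibbsExpect J lam f)
        * ((imhOpPhi4 J lam q)^[k] (fun ψ => f ψ - gibbsExpect J lam f)) φ * gibbsWeight J lam φ)
        / ∫ φ, (f φ - gibbsExpect J lam f) ^ 2 * gibbsWeight J lam φ)
      = 1 / 2 + ((∫ u in Ioi (0:ℝ), (∫ φ, (if gibbsWeight J lam φ / q φ < u then
            (f φ - gibbsExpect J lam f) * gibbsWeight J lam φ else 0)) ^ 2
            / (u * (1 - rejCurve volume (gibbsWeight J lam) q u)) ^ 2)
          + ∫ φ, (f φ - gibbsExpect J lam f) ^ 2 * gibbsWeight J lam φ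
            * (rejCurve volume (gibbsWeight J lam) q (gibbsWeight J lam φ / q φ)
              / (1 - rejCurve volume (gibbsWeight J lam) q (gibbsWeight J lam φ / q φ))))
          / ∫ φ, (f φ - gibbsExpect J lam f) ^ 2 * gibbsWeight J lam φ := by
  obtain ⟨hgm, hgb, -⟩ := centred_observable hlam J hfm hfb
  rw [imhOpPhi4_eq_imhOp]
  exact imhOp_tauInt_eq (μ := volume) (fun ψ => gibbsWeight_pos J lam ψ)
    (continuous_gibbsWeight J lam).measurable (integrable_gibbsWeight hlam J) hq0 hqm hqi hq1
    hgm hgb hI hJ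

end Lattice

end Summit.Ventures.LatticeQCDFlow.Exactness
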